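import Literature.Topology.FourManifolds.RegularSublevelSet
import Literature.Topology.FourManifolds.Cobordism
import HarnessLib

/-!
# Smooth maps into regular domains and into the boundary of a manifold with boundary

Topic `Literature/Topology/FourManifolds`. Two criteria of the type "a smooth map which takes
values in an embedded submanifold is smooth as a map into the submanifold" (Lee, *Introduction to
Smooth Manifolds* (2013), Cor. 5.30: restricting the codomain of a smooth map to an embedded
submanifold containing its image gives a smooth map), for the two submanifold structures built in
the tree by hand:

* `Literature.Topology.FourManifolds.HalfSliceAtlas.contMDiffAt_codRestrict`, `contMDiff_codRestrict`: regular domains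
  `S ⊆ M` with the manifold-with-boundary structure `Φ.chartedSpace` of a half-slice atlas
  (`RegularSublevelSet.lean`; e.g. regular sublevel sets `{f ≤ a}`). If `g : N → M` is `C^∞`
  (any source model `J`) with `g(N) ⊆ S`, then `g : N → S` is `C^∞` for the model `𝓡∂ (k + 1)`:
  in the chart of `S` induced by the half-slice chart `Θ` at `g x` the map reads `Θ ∘ g`.
* `Literature.Topology.FourManifolds.BoundaryManifold.contMDiffAt_codRestrict`, `contMDiff_codRestrict`: the boundary `∂W` of a
  `C^∞` manifold with boundary `W` (model `𝓡∂ (n + 1)`) with its structure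
  `BoundaryManifold.chartedSpace` (`Cobordism.lean`, Lee Thm. 5.11). If `g : N → W` is `C^∞` with
  `g(N) ⊆ ∂W`, then `g : N → ∂W` is `C^∞` for the model `𝓡 n`: in the boundary chart at `g x` the
  map reads `tail ∘ φ ∘ g` (`φ` the chart of `W`, `tail` dropping the vanishing first coordinate).

These are the tools by which maps into sublevel-set cobordisms and into their boundaries
(e.g. the ends of a cobordism, or the pieces of a connected-sum decomposition of a boundary) are
shown to be smooth.

## References

* J. M. Lee, *Introduction to Smooth Manifolds*, 2nd ed., GTM 218 (2013), Cor. 5.30, Thm. 5.11.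
  [LeeSmoothManifolds2013]
-/

open scoped Manifold ContDiff Topology
open Set Function

noncomputable section

universe u

namespace Literature.Topology.FourManifolds

/-- Local notation: `𝔼 n` is the model Euclidean space `EuclideanSpace ℝ (Fin n)`. -/
local notation "𝔼 " n:arg => EuclideanSpace ℝ (Fin n)
/-- Local notation: `ℍ n` is the model half-space `EuclideanHalfSpace n`. -/
local notation "ℍ " n:arg => EuclideanHalfSpace n

/-! ### Maps into a regular domain -/

namespace HalfSliceAtlas

variable {k : ℕ} {H : Type*} [TopologicalSpace H] {I : ModelWithCorners ℝ (𝔼 (k + 1)) H}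
  {M : Type u} [TopologicalSpace M] [ChartedSpace H M] {S : Set M} (Φ : HalfSliceAtlas I S)
  {E' H' : Type*} [NormedAddCommGroup E'] [NormedSpace ℝ E'] [TopologicalSpace H']
  {J : ModelWithCorners ℝ E' H'} {N : Type*} [TopologicalSpace N] [ChartedSpace H' N]

/-- **A smooth map with values in a regular domain is smooth into the domain** (pointwise form).
If `g : N → M` is `C^∞` at `x` and `g(N) ⊆ S`, then `g : N → S` is `C^∞` at `x` for the
manifold-with-boundary structure `Φ.chartedSpace`: the extended chart of `S` at `g x` is the
half-slice chart `Θ` there composed with the inclusion, so the map reads `Θ ∘ g` near `x`.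
Lee (2013), Cor. 5.30. [cite: LeeSmoothManifolds2013, Cor. 5.30] -/
theorem contMDiffAt_codRestrict [IsManifold I ∞ M] {g : N → M} (hS : ∀ x, g x ∈ S) {x : N}
    (hg : ContMDiffAt J I ∞ g x) :
    letI := Φ.chartedSpace
    ContMDiffAt J (𝓡∂ (k + 1)) ∞ (S.codRestrict g hS) x := by
  letI := Φ.chartedSpace
  haveI := Φ.isManifold
  rw [contMDiffAt_iff_target]
  refine ⟨hg.continuousAt.codRestrict hS, ?_⟩
  set p : S := S.codRestrict g hS x with hp
  set D := Φ.datum p with hD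
  have hsrc : g ⁻¹' D.Θ.source ∈ 𝓝 x :=
    hg.continuousAt.preimage_mem_nhds (D.Θ.open_source.mem_nhds (Φ.mem_source p))
  have hΘg : ContMDiffAt J 𝓘(ℝ, 𝔼 (k + 1)) ∞ (D.Θ ∘ g) x :=
    (D.contMDiffOn_toFun.contMDiffAt (D.Θ.open_source.mem_nhds (Φ.mem_source p))).comp x hg
  refine hΘg.congr_of_eventuallyEq ?_
  filter_upwards [hsrc] with y hy
  have hy' : S.codRestrict g hS y ∈ (D.chart p).source := hy
  rw [comp_apply, show extChartAt (𝓡∂ (k + 1)) p = (D.chart p).extend (𝓡∂ (k + 1)) from rfl,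
    D.extend_chart_apply hy']
  rfl

/-- **A smooth map with values in a regular domain is smooth into the domain.**
Lee (2013), Cor. 5.30. [cite: LeeSmoothManifolds2013, Cor. 5.30] -/
theorem contMDiff_codRestrict [IsManifold I ∞ M] {g : N → M} (hS : ∀ x, g x ∈ S)
    (hg : ContMDiff J I ∞ g) :
    letI := Φ.chartedSpace
    ContMDiff J (𝓡∂ (k + 1)) ∞ (S.codRestrict g hS) := by
  letI := Φ.chartedSpace
  exact fun x => Φ.contMDiffAt_codRestrict hS (hg x)

/-- A smooth map with values in a regular domain is smooth into the domain, on a set.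
Lee (2013), Cor. 5.30. [cite: LeeSmoothManifolds2013, Cor. 5.30] -/
theorem contMDiffOn_codRestrict [IsManifold I ∞ M] {g : N → M} (hS : ∀ x, g x ∈ S) {U : Set N}
    (hU : IsOpen U) (hg : ContMDiffOn J I ∞ g U) :
    letI := Φ.chartedSpace
    ContMDiffOn J (𝓡∂ (k + 1)) ∞ (S.codRestrict g hS) U := by
  letI := Φ.chartedSpace
  exact fun x hx =>
    (Φ.contMDiffAt_codRestrict hS (hg.contMDiffAt (hU.mem_nhds hx))).contMDiffWithinAt

end HalfSliceAtlas

/-! ### Maps into the boundary -/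

namespace BoundaryManifold

variable {n : ℕ} {W : Type u} [TopologicalSpace W] [ChartedSpace (ℍ (n + 1)) W]
  [IsManifold (𝓡∂ (n + 1)) ∞ W]
  {E' H' : Type*} [NormedAddCommGroup E'] [NormedSpace ℝ E'] [TopologicalSpace H']
  {J : ModelWithCorners ℝ E' H'} {N : Type*} [TopologicalSpace N] [ChartedSpace H' N]

/-- `tail n : ℝⁿ⁺¹ → ℝⁿ` is smooth in the manifold sense. [folklore] -/
theorem contMDiff_tail : ContMDiff 𝓘(ℝ, 𝔼 (n + 1)) 𝓘(ℝ, 𝔼 n) ∞ (tail n) :=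
  contMDiff_iff_contDiff.2 (contDiff_tail n)

/-- **A smooth map with values in the boundary is smooth into the boundary** (pointwise form).
If `g : N → W` is `C^∞` at `x` (target model `𝓡∂ (n + 1)`) and `g(N) ⊆ ∂W`, then `g : N → ∂W` is
`C^∞` at `x` for the boundary structure `BoundaryManifold.chartedSpace` (model `𝓡 n`): the chart
of `∂W` at `g x` is `tail ∘ φ ∘ val` with `φ` the chart of `W` at `g x`, so the map reads
`tail ∘ φ ∘ g`. Lee (2013), Thm. 5.11 and Cor. 5.30. [cite: LeeSmoothManifolds2013, Cor. 5.30] -/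
theorem contMDiffAt_codRestrict {g : N → W} (hB : ∀ x, g x ∈ (𝓡∂ (n + 1)).boundary W) {x : N}
    (hg : ContMDiffAt J (𝓡∂ (n + 1)) ∞ g x) :
    ContMDiffAt J (𝓡 n) ∞ (((𝓡∂ (n + 1)).boundary W).codRestrict g hB) x := by
  rw [contMDiffAt_iff_target]
  refine ⟨hg.continuousAt.codRestrict hB, ?_⟩
  have h2 := (contMDiffAt_iff_target.1 hg).2
  refine (contMDiff_tail.contMDiffAt.comp x h2).congr_of_eventuallyEq
    (Filter.Eventually.of_forall fun y => ?_)
  rfl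

/-- **A smooth map with values in the boundary is smooth into the boundary.**
Lee (2013), Cor. 5.30. [cite: LeeSmoothManifolds2013, Cor. 5.30] -/
theorem contMDiff_codRestrict {g : N → W} (hB : ∀ x, g x ∈ (𝓡∂ (n + 1)).boundary W)
    (hg : ContMDiff J (𝓡∂ (n + 1)) ∞ g) :
    ContMDiff J (𝓡 n) ∞ (((𝓡∂ (n + 1)).boundary W).codRestrict g hB) :=
  fun x => contMDiffAt_codRestrict hB (hg x)

/-- A smooth map with values in the boundary is smooth into the boundary, on a set.
Lee (2013), Cor. 5.30. [cite: LeeSmoothManifolds2013, Cor. 5.30] -/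
theorem contMDiffOn_codRestrict {g : N → W} (hB : ∀ x, g x ∈ (𝓡∂ (n + 1)).boundary W)
    {U : Set N} (hU : IsOpen U) (hg : ContMDiffOn J (𝓡∂ (n + 1)) ∞ g U) :
    ContMDiffOn J (𝓡 n) ∞ (((𝓡∂ (n + 1)).boundary W).codRestrict g hB) U :=
  fun _ hx => (contMDiffAt_codRestrict hB (hg.contMDiffAt (hU.mem_nhds hx))).contMDiffWithinAt

/-- **Smooth maps out of the boundary**: a map `h : ∂W → N` is `C^∞` at `p` as soon as it is the
restriction of a map `h' : W → N` which is `C^∞` at `p` (compose with the smooth embedding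
`Subtype.val : ∂W → W`, `BoundaryManifold.isSmoothEmbedding_subtype_val`). [folklore] -/
theorem contMDiffAt_comp_val {h' : W → N} {p : (𝓡∂ (n + 1)).boundary W}
    (hh : ContMDiffAt (𝓡∂ (n + 1)) J ∞ h' p.1) :
    ContMDiffAt (𝓡 n) J ∞ (h' ∘ Subtype.val : (𝓡∂ (n + 1)).boundary W → N) p :=
  hh.comp p ((isSmoothEmbedding_subtype_val (n := n) (W := W)).isImmersion.contMDiff p)

end BoundaryManifold

end Literature.Topology.FourManifolds
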